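import Summits.QuantumFields.BalabanUV.Beta.MultiscaleParametrixCubes

/-!
# Beta / MultiscaleCubesGeometry — NODE (w4-a′), THE GEOMETRY OF THE LAYER PREDICATE: for a GRADED covering cell family, ONE thickness
# clause of (2.1)–(2.2) SHAPE supplies the hypotheses (C0)(C1)(C2)(G1)(G2) of `MultiscaleParametrixCubes.parametrix_cubes` (MODEL; torus `UT N`)

INPUT (all DATA): the covering disjoint cube family of `MultiscaleDecay` (levels `J`, sides `S_l ≥ 1`, cells `k : K` of level `lvl k` with
corners `zc k`), a multiplier `M ≥ 1` (`M·S_j ∣ N_i`), an adjacency count «at most `n_adj` levels `l` with `S_j ≤ L·S_l ∧ S_l ≤ L·S_j` for every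
`j`», and ONE THICKNESS CLAUSE of [B6] (2.1)–(2.2) SHAPE: **(TH) two cells at torus distance `≤ R·M·S_{lvl k}` (the first cell's own scale,
`R ≥ 4d + 6`) have ADJACENT levels** — print: each layer `Λ_j` is a union of big blocks at least `R M` blocks of side `L^jη` wide, so a ball of
radius `≍ R M L^jη` round a point of `Λ_j` meets `Λ_{j−1}, Λ_j, Λ_{j+1}` only.
CONSTRUCTION: **`gradedLayer j z :≡`** the cube `z` of the `M S_j`-grid contains a point of a level-`j` cell; the cube family is
`MultiscaleCubesFamily.cubeFam` of this predicate, the hulls `MultiscaleParametrixCubes.cubeHull`.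
OUTPUT: §1 (C0) `gradedLayer_cover` (free: the cube of `x` on the grid of `x`'s own level), the witness lemmas, the cell diameter; §2 under
(TH): **`adj_of_rawFam_ne_zero`** (an active bump of layer `j` at a point of cell `k′` ⟹ `j` adjacent to `lvl k′`) ⟹ (G1)
`cubeFam_cellPt_eq_zero`, (C2) `card_layers_le` (≤ n_adj layers active at a point), (C1) `scales_cmp_of_rawFam_ne_zero`, (G2) `adj_of_cellMeets`.
The count (G3) and the END `parametrix_graded` are `MultiscaleParametrixGraded` (unit `b2b-balaban-beta-d4-p2`, GEN 10, MODEL crew; O.2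
skeleton v1.5.2 §8.10 ROUTE C).

HONEST FRAMING: discharging `BetaPertH` makes Bałaban's UV stability UNCONDITIONAL — NOT the continuum limit, NOT the
Clay problem.  HONEST DEPENDENCY (verbatim): «continuum YM on T⁴ ⇐ BetaPertH ∧ nine spine estimates (0/9 proved);
BetaPertH ⇐ (D1) ∧ (D4) ∧ CAP+tail; G-an2-4 gates asym, D1 and NE2/3/4.»  THIS MODULE DISCHARGES NOTHING of `BetaPertH`,
asserts NOTHING printed and cites nothing as a fact (ABSOLUTE RULE): [folklore] torus geometry; (TH) and the adjacency count are DATA of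
(2.1)–(2.2) SHAPE, not statements about Bałaban's domains.  LOCI (shape only): [B6] = `Balaban1984PropagatorsII` (2.1)–(2.2) p. 224,
(2.36)–(2.37) p. 229.  No class change on row D4 (width 0; D4 DISCHARGE NO DATE); NOT BetaPertH, NOT continuum, NOT Clay.
-/

namespace Summit.QuantumFields.BalabanUV.Beta.MultiscaleCubesGeometry

open Finset Function
open Summit.QuantumFields.BalabanUV.Beta.BoxPoincare (Box)
open Summit.QuantumFields.BalabanUV.Beta.MultiscaleCoerciveTorus
open Summit.QuantumFields.BalabanUV.Beta.MultiscaleDecayBudget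
open Literature.MathematicalPhysics.QuantumFieldTheory.Balaban1983to89
open B9Thm37Sum B9Thm37Glue B9Thm37GlueTorusInv
open Literature.MathematicalPhysics.QuantumFieldTheory.Balaban1983to89.B9Thm37GluePU (bsrc btgt bsrc_apply btgt_apply)
open Literature.MathematicalPhysics.QuantumFieldTheory.Balaban1983to89.B9Thm37GlueTorusCov (tblk)
open Literature.MathematicalPhysics.QuantumFieldTheory.Balaban1983to89.B9Thm37GlueTorusCovLevels (levelOp levelSum)
open B5TorusCover (UT Ctr ctrU hnu_holds)
open Summit.QuantumFields.BalabanUV.Beta.CovariantTowerL2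
open Summit.QuantumFields.BalabanUV.Beta.MultiscaleRemainderLeibniz
open Summit.QuantumFields.BalabanUV.Beta.MultiscaleParametrix
open Summit.QuantumFields.BalabanUV.Beta.MultiscaleParametrixTorus
open Summit.QuantumFields.BalabanUV.Beta.MultiscaleParametrixHull
open Summit.QuantumFields.BalabanUV.Beta.MultiscalePartitionNormalize
open Summit.QuantumFields.BalabanUV.Beta.MultiscalePartitionCubes
open Summit.QuantumFields.BalabanUV.Beta.MultiscaleCubesFamily
open Summit.QuantumFields.BalabanUV.Beta.MultiscaleParametrixCubes
open Summit.QuantumFields.BalabanUV.Beta.MultiscaleParametrixBoxes (one_le_MS)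

noncomputable section

variable {d : ℕ} {N : Fin d → ℕ} [∀ i, NeZero (N i)] {Cp J K : Type} [Fintype Cp] [DecidableEq Cp] [Fintype J] [Fintype K]
  (S : J → ℕ) (hS : ∀ l, 1 ≤ S l) (hdivS : ∀ l i, S l ∣ N i) (lvl : K → J) (zc : (k : K) → Ctr N (S (lvl k)))
  (M : ℕ) (hM : 1 ≤ M) (hMdiv : ∀ j i, M * S j ∣ N i)

/-! ## §1 The layer predicate of a graded cell family, its cover clause and its witnesses -/

/-- MODEL bookkeeping (a predicate, not a fact): **the layer predicate of the graded cell family** — the cube `z` of the `M S_j`-grid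
belongs to layer `j` iff it contains a point of a cell of level `j` (locus of the shape: [B6] (2.36) p. 229, the cubes `□ ⊂ Λ_j` of size
`≍ M L^jη`). [folklore] -/
def gradedLayer (j : J) (z : Ctr N (M * S j)) : Prop :=
  ∃ k, ∃ v : Box d (S (lvl k)), lvl k = j ∧ tblk (one_le_MS S hS hM j) (hMdiv j) (cellPt S hS hdivS lvl zc k v) = z

omit [Fintype J] [Fintype K] in
/-- **(C0) THE COVER CLAUSE, FREE**: every point lies in a layer cube — the cube of `x` on the grid of `x`'s own level. [folklore] -/
theorem gradedLayer_cover (hcover : ∀ x : UT N, ∃ k, ∃ v : Box d (S (lvl k)), cellPt S hS hdivS lvl zc k v = x) (x : UT N) :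
    ∃ j, gradedLayer S hS hdivS lvl zc M hM hMdiv j (tblk (one_le_MS S hS hM j) (hMdiv j) x) := by
  obtain ⟨k, v, hkv⟩ := hcover x
  exact ⟨lvl k, k, v, rfl, by rw [hkv]⟩

omit [Fintype J] [Fintype K] in
/-- **Witness of a layer cube**: a point of a level-`j` cell within `d·M S_j` of the cube's corner. [folklore] -/
theorem gradedLayer_witness [NeZero d] {j : J} {z : Ctr N (M * S j)} (h : gradedLayer S hS hdivS lvl zc M hM hMdiv j z) :
    ∃ k, ∃ v : Box d (S (lvl k)), lvl k = j ∧ dist (cellPt S hS hdivS lvl zc k v) (ctrU N (M * S j) z) ≤ d * ((M : ℝ) * S j) := by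
  obtain ⟨k, v, hk, hz⟩ := h
  refine ⟨k, v, hk, ?_⟩
  have h1 := dist_ctrU_tblk_le (one_le_MS S hS hM j) (hMdiv j) (cellPt S hS hdivS lvl zc k v)
  rw [hz] at h1
  refine h1.trans ?_
  have h2 : d * (M * S j - 1) ≤ d * (M * S j) := Nat.mul_le_mul_left d (Nat.sub_le _ _)
  calc ((d * (M * S j - 1) : ℕ) : ℝ) ≤ ((d * (M * S j) : ℕ) : ℝ) := by exact_mod_cast h2
    _ = d * ((M : ℝ) * S j) := by push_cast; ring

omit [Fintype J] [Fintype K] in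
/-- **An active raw bump reads its layer and its support**: `rawFam_{(j,z)}(x) ≠ 0 ⟹ gradedLayer j z ∧ dist(x, ctrU z) ≤ (d+2)·M S_j`.
[folklore] -/
theorem layer_and_dist_of_rawFam_ne_zero [NeZero d] {p : Σ j : J, Ctr N (M * S j)} {x : UT N}
    (h : rawFam S hS M hM hMdiv (gradedLayer S hS hdivS lvl zc M hM hMdiv) p x ≠ 0) :
    gradedLayer S hS hdivS lvl zc M hM hMdiv p.1 p.2 ∧ dist x (ctrU N (M * S p.1) p.2) ≤ (d + 2) * ((M : ℝ) * S p.1) := by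
  obtain ⟨hin, hth⟩ := rawFam_ne_zero S hS M hM hMdiv _ h
  refine ⟨hin, ?_⟩
  by_contra hfar
  push Not at hfar
  apply hth
  apply thickSq_eq_zero_of_far
  rw [show (((d + 2) * (M * S p.1) : ℕ) : ℝ) = (d + 2) * ((M : ℝ) * S p.1) by push_cast; ring]
  exact hfar.le

omit [Fintype J] [Fintype K] in
/-- **An active raw bump has a level-`j` cell point within `(2d+2)·M S_j`.** [folklore] -/
theorem exists_near_of_rawFam_ne_zero [NeZero d] {p : Σ j : J, Ctr N (M * S j)} {x : UT N}
    (h : rawFam S hS M hM hMdiv (gradedLayer S hS hdivS lvl zc M hM hMdiv) p x ≠ 0) :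
    ∃ k, ∃ v : Box d (S (lvl k)), lvl k = p.1 ∧ dist (cellPt S hS hdivS lvl zc k v) x ≤ (2 * d + 2) * ((M : ℝ) * S p.1) := by
  obtain ⟨hin, hx⟩ := layer_and_dist_of_rawFam_ne_zero S hS hdivS lvl zc M hM hMdiv h
  obtain ⟨k, v, hk, hu⟩ := gradedLayer_witness S hS hdivS lvl zc M hM hMdiv hin
  refine ⟨k, v, hk, ?_⟩
  calc dist (cellPt S hS hdivS lvl zc k v) x
      ≤ dist (cellPt S hS hdivS lvl zc k v) (ctrU N (M * S p.1) p.2) + dist (ctrU N (M * S p.1) p.2) x := dist_triangle _ _ _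
    _ ≤ d * ((M : ℝ) * S p.1) + (d + 2) * ((M : ℝ) * S p.1) := add_le_add hu (by rw [dist_comm]; exact hx)
    _ = (2 * d + 2) * ((M : ℝ) * S p.1) := by ring

omit [Fintype K] in
/-- **An active box has a level-`j` cell point within `d·M S_j` of its corner.** [folklore] -/
theorem exists_witness_of_active [NeZero d] {p : Σ j : J, Ctr N (M * S j)}
    (hact : ∃ y, cubeFam S hS M hM hMdiv (gradedLayer S hS hdivS lvl zc M hM hMdiv) p y ≠ 0) :
    ∃ k, ∃ v : Box d (S (lvl k)), lvl k = p.1 ∧ dist (cellPt S hS hdivS lvl zc k v) (ctrU N (M * S p.1) p.2) ≤ d * ((M : ℝ) * S p.1) := by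
  obtain ⟨y, hy⟩ := hact
  have hraw : rawFam S hS M hM hMdiv (gradedLayer S hS hdivS lvl zc M hM hMdiv) p y ≠ 0 :=
    fun h0 => hy (cubeFam_eq_zero S hS M hM hMdiv _ h0)
  exact gradedLayer_witness S hS hdivS lvl zc M hM hMdiv (rawFam_ne_zero S hS M hM hMdiv _ hraw).1

omit [Fintype J] [Fintype K] in
/-- **The diameter of a cell**: two points of cell `k` are within `2d·(S_{lvl k} − 1)` (comb paths to the corner). [folklore] -/
theorem dist_cellPt_cellPt_le [NeZero d] (k : K) (v w : Box d (S (lvl k))) :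
    dist (cellPt S hS hdivS lvl zc k v) (cellPt S hS hdivS lvl zc k w) ≤ 2 * ((d * (S (lvl k) - 1) : ℕ) : ℝ) := by
  have e : ∀ u : Box d (S (lvl k)), tblk (hS (lvl k)) (hdivS (lvl k)) (cellPt S hS hdivS lvl zc k u) = zc k :=
    fun u => by rw [cellPt, tblk_cubePt]
  have h1 := dist_ctrU_tblk_le (hS (lvl k)) (hdivS (lvl k)) (cellPt S hS hdivS lvl zc k v)
  have h2 := dist_ctrU_tblk_le (hS (lvl k)) (hdivS (lvl k)) (cellPt S hS hdivS lvl zc k w)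
  rw [e] at h1 h2
  calc dist (cellPt S hS hdivS lvl zc k v) (cellPt S hS hdivS lvl zc k w)
      ≤ dist (cellPt S hS hdivS lvl zc k v) (ctrU N (S (lvl k)) (zc k)) + dist (ctrU N (S (lvl k)) (zc k)) (cellPt S hS hdivS lvl zc k w) :=
        dist_triangle _ _ _
    _ ≤ ((d * (S (lvl k) - 1) : ℕ) : ℝ) + ((d * (S (lvl k) - 1) : ℕ) : ℝ) := add_le_add h1 (by rw [dist_comm]; exact h2)
    _ = 2 * ((d * (S (lvl k) - 1) : ℕ) : ℝ) := by ring

/-! ## §2 The thickness clause (TH) at work: adjacency of active layers, (G1), (C2), (C1), (G2) -/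

section Thick

variable {L : ℕ} {R : ℝ}

omit [Fintype J] [Fintype K] in
/-- **ACTIVE LAYERS ARE ADJACENT (the heart of (C2)/(G1))**: under (TH) with `R ≥ 4d + 6`, a raw bump of layer `j` nonzero at a point of
cell `k′` forces `S_j ≤ L·S_{lvl k′} ∧ S_{lvl k′} ≤ L·S_j` (the level-`j` witness and the point are `≤ (2d+2)M S_j` apart).
[cite: Balaban1984PropagatorsII, (2.1)-(2.2) p.224] -/
theorem adj_of_rawFam_ne_zero [NeZero d] (hR : 4 * (d : ℝ) + 6 ≤ R)
    (hthick : ∀ (k k' : K) (v : Box d (S (lvl k))) (v' : Box d (S (lvl k'))),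
      dist (cellPt S hS hdivS lvl zc k v) (cellPt S hS hdivS lvl zc k' v') ≤ R * ((M : ℝ) * S (lvl k)) →
        S (lvl k) ≤ L * S (lvl k') ∧ S (lvl k') ≤ L * S (lvl k))
    {p : Σ j : J, Ctr N (M * S j)} {k' : K} {v' : Box d (S (lvl k'))}
    (h : rawFam S hS M hM hMdiv (gradedLayer S hS hdivS lvl zc M hM hMdiv) p (cellPt S hS hdivS lvl zc k' v') ≠ 0) :
    S p.1 ≤ L * S (lvl k') ∧ S (lvl k') ≤ L * S p.1 := by
  obtain ⟨k, v, hk, hu⟩ := exists_near_of_rawFam_ne_zero S hS hdivS lvl zc M hM hMdiv h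
  obtain ⟨j, z⟩ := p
  simp only at hk hu ⊢
  subst hk
  have hMS : (0 : ℝ) ≤ (M : ℝ) * S (lvl k) := by positivity
  exact hthick k k' v v' (hu.trans (mul_le_mul_of_nonneg_right (by linarith) hMS))

omit [Fintype K] in
/-- **(G1)**: the cube bumps of layer `j` VANISH on the cells of every level not adjacent to `j`. [folklore] -/
theorem cubeFam_cellPt_eq_zero [NeZero d] (hR : 4 * (d : ℝ) + 6 ≤ R)
    (hthick : ∀ (k k' : K) (v : Box d (S (lvl k))) (v' : Box d (S (lvl k'))),
      dist (cellPt S hS hdivS lvl zc k v) (cellPt S hS hdivS lvl zc k' v') ≤ R * ((M : ℝ) * S (lvl k)) →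
        S (lvl k) ≤ L * S (lvl k') ∧ S (lvl k') ≤ L * S (lvl k))
    (p : Σ j : J, Ctr N (M * S j)) (k : K) (hk : ¬ (S p.1 ≤ L * S (lvl k) ∧ S (lvl k) ≤ L * S p.1)) (v : Box d (S (lvl k))) :
    cubeFam S hS M hM hMdiv (gradedLayer S hS hdivS lvl zc M hM hMdiv) p (cellPt S hS hdivS lvl zc k v) = 0 := by
  by_contra hne
  exact hk (adj_of_rawFam_ne_zero S hS hdivS lvl zc M hM hMdiv hR hthick fun h0 => hne (cubeFam_eq_zero S hS M hM hMdiv _ h0))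

omit [Fintype K] in
/-- **(C2)**: at most `n_adj` layers are active at any point (the active layers are adjacent to the level of the point's cell). [folklore] -/
theorem card_layers_le [NeZero d] (hcover : ∀ x : UT N, ∃ k, ∃ v : Box d (S (lvl k)), cellPt S hS hdivS lvl zc k v = x)
    (hR : 4 * (d : ℝ) + 6 ≤ R)
    (hthick : ∀ (k k' : K) (v : Box d (S (lvl k))) (v' : Box d (S (lvl k'))),
      dist (cellPt S hS hdivS lvl zc k v) (cellPt S hS hdivS lvl zc k' v') ≤ R * ((M : ℝ) * S (lvl k)) →
        S (lvl k) ≤ L * S (lvl k') ∧ S (lvl k') ≤ L * S (lvl k))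
    {nadj : ℕ} (hadj : ∀ j, (univ.filter fun l => S j ≤ L * S l ∧ S l ≤ L * S j).card ≤ nadj) (x : UT N) :
    (univ.filter fun j : J => ∃ z : Ctr N (M * S j),
      rawFam S hS M hM hMdiv (gradedLayer S hS hdivS lvl zc M hM hMdiv) ⟨j, z⟩ x ≠ 0).card ≤ nadj := by
  classical
  obtain ⟨k', v', hx⟩ := hcover x
  refine le_trans (Finset.card_le_card ?_) (hadj (lvl k'))
  intro j hj
  rw [mem_filter] at hj ⊢
  obtain ⟨z, hz⟩ := hj.2
  rw [← hx] at hz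
  have h := adj_of_rawFam_ne_zero S hS hdivS lvl zc M hM hMdiv hR hthick hz
  exact ⟨mem_univ _, h.2, h.1⟩

omit [Fintype J] [Fintype K] in
/-- **(C1)**: boxes active at points within distance `2` have comparable scales `S_j ≤ L·S_{j′}` (trivial when `S_j ≤ S_{j′}`; otherwise
the two witnesses are `≤ (4d+6)M S_j` apart and (TH) applies at the coarser one). [folklore] -/
theorem scales_cmp_of_rawFam_ne_zero [NeZero d] (hL : 1 ≤ L) (hR : 4 * (d : ℝ) + 6 ≤ R)
    (hthick : ∀ (k k' : K) (v : Box d (S (lvl k))) (v' : Box d (S (lvl k'))),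
      dist (cellPt S hS hdivS lvl zc k v) (cellPt S hS hdivS lvl zc k' v') ≤ R * ((M : ℝ) * S (lvl k)) →
        S (lvl k) ≤ L * S (lvl k') ∧ S (lvl k') ≤ L * S (lvl k))
    (p q : Σ j : J, Ctr N (M * S j)) (x y : UT N) (hxy : dist x y ≤ 2)
    (hp : rawFam S hS M hM hMdiv (gradedLayer S hS hdivS lvl zc M hM hMdiv) p x ≠ 0)
    (hq : rawFam S hS M hM hMdiv (gradedLayer S hS hdivS lvl zc M hM hMdiv) q y ≠ 0) : S p.1 ≤ L * S q.1 := by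
  by_cases hle : S p.1 ≤ S q.1
  · exact hle.trans (Nat.le_mul_of_pos_left _ hL)
  · obtain ⟨k, v, hk, hu⟩ := exists_near_of_rawFam_ne_zero S hS hdivS lvl zc M hM hMdiv hp
    obtain ⟨k', v', hk', hw⟩ := exists_near_of_rawFam_ne_zero S hS hdivS lvl zc M hM hMdiv hq
    have hSq : (S q.1 : ℝ) ≤ S p.1 := by exact_mod_cast (not_le.mp hle).le
    have hM0 : (0 : ℝ) ≤ M := Nat.cast_nonneg _
    have hMSq : (M : ℝ) * S q.1 ≤ (M : ℝ) * S p.1 := mul_le_mul_of_nonneg_left hSq hM0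
    have hMS1 : (1 : ℝ) ≤ (M : ℝ) * S p.1 := by
      have h1 := one_le_MS S hS hM p.1
      have h2 : ((M * S p.1 : ℕ) : ℝ) = (M : ℝ) * S p.1 := by push_cast; ring
      rw [← h2]; exact_mod_cast h1
    have hd0 : (0 : ℝ) ≤ 2 * d + 2 := by positivity
    have hMSq' : (2 * d + 2) * ((M : ℝ) * S q.1) ≤ (2 * d + 2) * ((M : ℝ) * S p.1) := mul_le_mul_of_nonneg_left hMSq hd0
    have hdist : dist (cellPt S hS hdivS lvl zc k v) (cellPt S hS hdivS lvl zc k' v') ≤ R * ((M : ℝ) * S (lvl k)) := by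
      rw [hk]
      calc dist (cellPt S hS hdivS lvl zc k v) (cellPt S hS hdivS lvl zc k' v')
          ≤ dist (cellPt S hS hdivS lvl zc k v) x + dist x y + dist y (cellPt S hS hdivS lvl zc k' v') := dist_triangle4 _ _ _ _
        _ ≤ (2 * d + 2) * ((M : ℝ) * S p.1) + 2 + (2 * d + 2) * ((M : ℝ) * S q.1) :=
            add_le_add (add_le_add hu hxy) (by rw [dist_comm]; exact hw)
        _ ≤ (4 * d + 6) * ((M : ℝ) * S p.1) := by linarith
        _ ≤ R * ((M : ℝ) * S p.1) := mul_le_mul_of_nonneg_right hR (by positivity)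
    have h := (hthick k k' v v' hdist).1
    rw [hk, hk'] at h
    exact h

omit [Fintype K] in
/-- **(G2) and the adjacency of a hull's cells**: for an ACTIVE box `(j, z)`, every family cell meeting the `((d+2)M S_j + 1)`-ball round
its corner has a level adjacent to `j` (the cell's meeting point and the box's witness are `≤ (2d+3)M S_j` apart). [cite: Balaban1984PropagatorsII, (2.37) p.229] -/
theorem adj_of_cellMeets [NeZero d] (hR : 4 * (d : ℝ) + 6 ≤ R)
    (hthick : ∀ (k k' : K) (v : Box d (S (lvl k))) (v' : Box d (S (lvl k'))),
      dist (cellPt S hS hdivS lvl zc k v) (cellPt S hS hdivS lvl zc k' v') ≤ R * ((M : ℝ) * S (lvl k)) →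
        S (lvl k) ≤ L * S (lvl k') ∧ S (lvl k') ≤ L * S (lvl k))
    (j : J) (z : Ctr N (M * S j)) (hact : ∃ y, cubeFam S hS M hM hMdiv (gradedLayer S hS hdivS lvl zc M hM hMdiv) ⟨j, z⟩ y ≠ 0) (k : K)
    (hk : CellMeets S hS hdivS lvl zc k (ctrU N (M * S j) z) ((((d + 2) * (M * S j) : ℕ) : ℝ) + 1)) :
    S j ≤ L * S (lvl k) ∧ S (lvl k) ≤ L * S j := by
  obtain ⟨k₀, v₀, hk₀, hu⟩ := exists_witness_of_active S hS hdivS lvl zc M hM hMdiv hact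
  obtain ⟨v, hv⟩ := hk
  simp only at hk₀ hu
  subst hk₀
  have hMS1 : (1 : ℝ) ≤ (M : ℝ) * S (lvl k₀) := by
    have h1 := one_le_MS S hS hM (lvl k₀)
    have h2 : ((M * S (lvl k₀) : ℕ) : ℝ) = (M : ℝ) * S (lvl k₀) := by push_cast; ring
    rw [← h2]; exact_mod_cast h1
  have hcast : (((d + 2) * (M * S (lvl k₀)) : ℕ) : ℝ) = (d + 2) * ((M : ℝ) * S (lvl k₀)) := by push_cast; ring
  rw [hcast] at hv
  have hd0 : (0 : ℝ) ≤ d * ((M : ℝ) * S (lvl k₀)) := by positivity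
  have hdist : dist (cellPt S hS hdivS lvl zc k₀ v₀) (cellPt S hS hdivS lvl zc k v) ≤ R * ((M : ℝ) * S (lvl k₀)) := by
    calc dist (cellPt S hS hdivS lvl zc k₀ v₀) (cellPt S hS hdivS lvl zc k v)
        ≤ dist (cellPt S hS hdivS lvl zc k₀ v₀) (ctrU N (M * S (lvl k₀)) z) + dist (ctrU N (M * S (lvl k₀)) z) (cellPt S hS hdivS lvl zc k v) :=
          dist_triangle _ _ _
      _ ≤ d * ((M : ℝ) * S (lvl k₀)) + ((d + 2) * ((M : ℝ) * S (lvl k₀)) + 1) := add_le_add hu (by rw [dist_comm]; exact hv)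
      _ ≤ (4 * d + 6) * ((M : ℝ) * S (lvl k₀)) := by nlinarith [hd0]
      _ ≤ R * ((M : ℝ) * S (lvl k₀)) := mul_le_mul_of_nonneg_right hR (by positivity)
  exact hthick k₀ k v₀ v hdist

end Thick

end

end Summit.QuantumFields.BalabanUV.Beta.MultiscaleCubesGeometry
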